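import Literature.Geometry.Lorentzian.FinalState
import Literature.Geometry.Lorentzian.Genericity
import HarnessLib

/-!
# Route PhotonSphereChannels · crux `TameCensorship` (stmt-FinalStateConjecture-17431) · line `Sketch`, skeleton v8 ·
# stub `stub_robustMono`: robust escapability is MONOTONE in the property (def-free, abstract in Q Q')

Helper file (`--supports stmt-FinalStateConjecture-17431`) of line `Sketch` (lead c4, 2026-08-17): one brick of the
def-free TRANSPORT PACKAGE of the robust legend (robust escapability of a property `Q` of initial data at a datum `d`:
every compactly supported smooth admissible probe through `d` enriches, along an injective linear map of parameter
spaces, to one along all of whose further enrichments an open dense set of radial directions has `Q` for all small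
non-zero parameters).

What: robust escapability at `d` is MONOTONE in the property along implications `Q → Q'` that are only required to hold
on the admissible class `admissibleVacuumData X`. Why: the composition `TameCensorship_of` of the skeleton upgrades the
robust form of one clause of K3 to a weaker (implied) clause, and the implication it has in hand is only valid for
admissible data; this lemma is the glue (sibling of the `∧`-closure `stub_robustAnd` in
`Theorems/PhotonSphereChannelsTameCensorshipRobustAnd.lean`). Proof: keep the enrichment `(n, G₁, L)` and, for every
further enrichment `(p, G₂, L')`, the same open dense direction set `U` and the same radius `δ`; a good parameter `t • v`
for `Q` is good for `Q'` because the member `G₂ (t • v)` of the probe `G₂` is admissible (third conjunct of the probe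
legend). Pure logic; no choice, no topology beyond what the hypothesis already provides. [folklore]
-/

set_option linter.dupNamespace false

open Literature.Geometry.Lorentzian
open scoped Manifold ContDiff Topology
open Filter Set Function

noncomputable section

namespace Summit.FinalStateConjecture.FinalStateConjecture.Theorems.PhotonSphereChannels.TameCensorshipUnwind

/-- **Stub `stub_robustMono` of line `Sketch` (skeleton v8) for the crux `PhotonSphereChannels.TameCensorship`
(stmt-FinalStateConjecture-17431): robust escapability is MONOTONE in the property.** For an arbitrary datum `d` and two
properties `Q`, `Q'` of initial data with `Q D → Q' D` for every ADMISSIBLE datum `D`: if every compactly supported smooth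
admissible probe through `d` enriches (along an injective linear map of parameter spaces) to one along all of whose
further enrichments an open dense set of radial directions has `Q` for all small non-zero parameters, then the same holds
with `Q'` in place of `Q`. Proof idea: take the same enrichment, the same open dense set of directions and the same
radius; every member `G₂ (t • v)` of a probe lies in `admissibleVacuumData X` (third conjunct of the probe legend), so the
implication `Q → Q'` applies to it. Stated DEF-FREE (the registered stub signature inlines the probe legend) so that it
does not depend on the skeleton's local definitions. [folklore] -/
theorem stub_robustMono :
    ∀ (X : Type) [TopologicalSpace X] [ChartedSpace E3 X] [IsManifold (𝓡 3) ∞ X] [T2Space X]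
    [SecondCountableTopology X] [ConnectedSpace X] (d : InitialDataSet (𝓡 3) X) (Q Q' : InitialDataSet (𝓡 3) X →
    Prop), (∀ D ∈ admissibleVacuumData X, Q D → Q' D) → (∀ (m : ℕ) (G : EuclideanSpace ℝ (Fin m) →
    InitialDataSet (𝓡 3) X), (InitialDataSet.IsSmoothDataFamily m G ∧ G 0 = d ∧ (∀ c, G c ∈ admissibleVacuumData
    X) ∧ ∃ K : Set X, IsCompact K ∧ ∀ c, ∀ x ∉ K, (G c).h.inner x = d.h.inner x ∧ (G c).k x = d.k x) → ∃ (n : ℕ)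
    (G₁ : EuclideanSpace ℝ (Fin n) → InitialDataSet (𝓡 3) X) (L : EuclideanSpace ℝ (Fin m) →ₗ[ℝ] EuclideanSpace
    ℝ (Fin n)), Function.Injective L ∧ (InitialDataSet.IsSmoothDataFamily n G₁ ∧ G₁ 0 = d ∧ (∀ c, G₁ c ∈
    admissibleVacuumData X) ∧ ∃ K : Set X, IsCompact K ∧ ∀ c, ∀ x ∉ K, (G₁ c).h.inner x = d.h.inner x ∧ (G₁ c).k
    x = d.k x) ∧ (∀ c, G₁ (L c) = G c) ∧ ∀ (p : ℕ) (G₂ : EuclideanSpace ℝ (Fin p) → InitialDataSet (𝓡 3) X) (L'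
    : EuclideanSpace ℝ (Fin n) →ₗ[ℝ] EuclideanSpace ℝ (Fin p)), Function.Injective L' →
    (InitialDataSet.IsSmoothDataFamily p G₂ ∧ G₂ 0 = d ∧ (∀ c, G₂ c ∈ admissibleVacuumData X) ∧ ∃ K : Set X,
    IsCompact K ∧ ∀ c, ∀ x ∉ K, (G₂ c).h.inner x = d.h.inner x ∧ (G₂ c).k x = d.k x) → (∀ c, G₂ (L' c) = G₁ c) →
    ∃ U : Set (EuclideanSpace ℝ (Fin p)), IsOpen U ∧ Dense U ∧ ∀ v ∈ U, ∃ δ : ℝ, 0 < δ ∧ ∀ t : ℝ, t ≠ 0 → |t| <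
    δ → Q (G₂ (t • v))) → ∀ (m : ℕ) (G : EuclideanSpace ℝ (Fin m) → InitialDataSet (𝓡 3) X),
    (InitialDataSet.IsSmoothDataFamily m G ∧ G 0 = d ∧ (∀ c, G c ∈ admissibleVacuumData X) ∧ ∃ K : Set X,
    IsCompact K ∧ ∀ c, ∀ x ∉ K, (G c).h.inner x = d.h.inner x ∧ (G c).k x = d.k x) → ∃ (n : ℕ) (G₁ :
    EuclideanSpace ℝ (Fin n) → InitialDataSet (𝓡 3) X) (L : EuclideanSpace ℝ (Fin m) →ₗ[ℝ] EuclideanSpace ℝ (Fin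
    n)), Function.Injective L ∧ (InitialDataSet.IsSmoothDataFamily n G₁ ∧ G₁ 0 = d ∧ (∀ c, G₁ c ∈
    admissibleVacuumData X) ∧ ∃ K : Set X, IsCompact K ∧ ∀ c, ∀ x ∉ K, (G₁ c).h.inner x = d.h.inner x ∧ (G₁ c).k
    x = d.k x) ∧ (∀ c, G₁ (L c) = G c) ∧ ∀ (p : ℕ) (G₂ : EuclideanSpace ℝ (Fin p) → InitialDataSet (𝓡 3) X) (L'
    : EuclideanSpace ℝ (Fin n) →ₗ[ℝ] EuclideanSpace ℝ (Fin p)), Function.Injective L' →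
    (InitialDataSet.IsSmoothDataFamily p G₂ ∧ G₂ 0 = d ∧ (∀ c, G₂ c ∈ admissibleVacuumData X) ∧ ∃ K : Set X,
    IsCompact K ∧ ∀ c, ∀ x ∉ K, (G₂ c).h.inner x = d.h.inner x ∧ (G₂ c).k x = d.k x) → (∀ c, G₂ (L' c) = G₁ c) →
    ∃ U : Set (EuclideanSpace ℝ (Fin p)), IsOpen U ∧ Dense U ∧ ∀ v ∈ U, ∃ δ : ℝ, 0 < δ ∧ ∀ t : ℝ, t ≠ 0 → |t| <
    δ → Q' (G₂ (t • v)) := by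
  intro X _ _ _ _ _ _ d Q Q' hQ h m G hG
  obtain ⟨n, G₁, L, hL, hG₁, hLG, hR⟩ := h m G hG
  refine ⟨n, G₁, L, hL, hG₁, hLG, fun p G₂ L' hL' hG₂ hL'G => ?_⟩
  obtain ⟨U, hUo, hUd, hU⟩ := hR p G₂ L' hL' hG₂ hL'G
  refine ⟨U, hUo, hUd, fun v hv => ?_⟩
  obtain ⟨δ, hδ, hgood⟩ := hU v hv
  exact ⟨δ, hδ, fun t ht htδ => hQ _ (hG₂.2.2.1 _) (hgood t ht htδ)⟩

end Summit.FinalStateConjecture.FinalStateConjecture.Theorems.PhotonSphereChannels.TameCensorshipUnwind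

end
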